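import Summits.NavierStokesRegularity.NavierStokesRegularity.Theorems.EfficiencyFloorRigidExitReferenceFlowWindow
import Summits.NavierStokesRegularity.NavierStokesRegularity.Theorems.EfficiencyFloorRigidExitOrbitRateByName
import HarnessLib

/-!
# Route `EfficiencyFloor`, support `RigidExit` (stmt-NavierStokesRegularity-25513) on the `ProductionEfficiencyDecay` ladder
# (stmt-NavierStokesRegularity-22866): INSTANT EXIT OF THE REFERENCE FLOW — the residue (R-exit) under clause (a)

Helper file (`--supports stmt-NavierStokesRegularity-22866`; line `efficiency_floor`). The landed item (i) of `RigidExit`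
(`OrbitRate.no_maximiserInterval_of_classification`, `…earlyDeficit_everywhere_of_classification`, p838767) is written for flows of the
ROUTE CLASS (maximal classical Leray–Hopf, rapidly decaying datum). The reduction `ReferenceShadowing.rigidExit_of_referenceShadowing`
(p839834) needs it for the REFERENCE FLOW through a normalised maximiser `m` (Leray's local regular flow, `ReferenceFlow.*`,
p839713…p839813), which is classical only on `(0,T]` and is not in the class. This file re-runs the mechanism in that setting:

* `tendsto_slope_time_Ioc` — right difference quotients of a classical solution on `(0,T]` converge to `∂ₜv(s)` at interior times;
* `no_maximiserInterval_ref` — under the classification half of clause (a) (VERBATIM `partA`), along ANY classical solution on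
  `(0,T]` with Sobolev bounds on every `[δ,T]`, no interval `[s,s₁] ⊂ (0,T)` consists of normalised maximisers: `∂ₜv(s)` would be
  an infinitesimal symmetry (tangent cone of the maximiser set = symmetry directions, `TangentCone.tangentCone_of_rate ∘
  OrbitRate.rate_of_classification`) and the momentum equation would make `v(s)` a relative equilibrium, contradicting the PROVED
  clause (b) (`ProfileLiouville.partB_holds`);
* `referenceDeficit` — **(R-exit)**: for the sharp constant, `ν > 0`, a normalised maximiser `m`, its reference flow `(v,q)` on
  `[0,T]` and `0 < η < 1` with `η·W_m < T` (`W_m = (64ν³/(27c⁴))·Z(m)⁻²`): there is `θ > 0` with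
  `Z(v(η·W_m))²·(1 − η + 4θ) ≤ Z(m)²` — a STRICT early cubic-law deficit of the reference flow (positivity-free form; if
  `Z(v(ηW_m)) = 0` it is trivial, otherwise positivity propagates backwards (`ReferenceFlow.enstrophy_pos_of_pos_right`), a
  non-maximiser instant exists in `[ηW/3, 2ηW/3]`, it is a strict instant of the cubic law (`SaturationExit.saturated_iff_normalised`),
  and one strict instant makes the integrated law strict (`SaturationExit.inv_sq_sub_lt_of_strict_instant`) on top of the window
  ceiling `ReferenceFlow.enstrophy_sq_mul_le`);
* `referenceDeficit_of_maximiserSetRigidity` — the same from the route decl `MaximiserSetRigidity` BY NAME.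

HONEST FRAMING: statements about the reference flow under the OPEN clause (a); `RigidExit`, `NearMaximiserBoundedAmplification`,
`LerayFloorGap`, `ProductionEfficiencyDecay` (stmt-22866) and Navier–Stokes regularity stay OPEN; no summit statement is proved.
[folklore]
-/

-- the problem directory repeats the summit name (`NavierStokesRegularity/NavierStokesRegularity`)
set_option linter.dupNamespace false

noncomputable section

open Set Filter MeasureTheory Topology Function
open scoped InnerProductSpace RealInnerProductSpace ENNReal NNReal Laplacian
open Literature.Analysis.FluidPDE

namespace Summit.NavierStokesRegularity.NavierStokesRegularity.Theorems

namespace RigidExit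

namespace ReferenceExit

open NearMaximiserBoundedAmplification MaximiserSetRigidity.ProfileLiouville TangentCone OrbitRate ReferenceFlow

/-! ## §1 Time slopes of a classical solution on `(0,T]` -/

/-- Right difference quotients along a classical solution on `(0,T]` converge pointwise to the time derivative at interior times
(`∂ₜ = timeDerivWithin (Ioc 0 T)`). [folklore] -/
theorem tendsto_slope_time_Ioc {ν T : ℝ} {v : ℝ → EuclideanSpace ℝ (Fin 3) → EuclideanSpace ℝ (Fin 3)}
    {q : ℝ → EuclideanSpace ℝ (Fin 3) → ℝ} (hcl : IsClassicalNSSolutionOn (Ioc 0 T) ν 0 v q)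
    {s : ℝ} (hs : s ∈ Ioo 0 T) {τ : ℕ → ℝ} (hτpos : ∀ n, 0 < τ n) (hτ : Tendsto τ atTop (𝓝 0)) (x : EuclideanSpace ℝ (Fin 3)) :
    Tendsto (fun n => (τ n)⁻¹ • (v (s + τ n) x - v s x)) atTop (𝓝 (timeDerivWithin (Ioc 0 T) v s x)) := by
  have hsm : IsSmoothSpaceTimeOn (Ioc 0 T) v := hcl.smooth_velocity
  have hmem : Ioc 0 T ∈ 𝓝 s := Ioc_mem_nhds hs.1 hs.2
  have hd : HasDerivAt (fun t => v t x) (timeDerivWithin (Ioc 0 T) v s x) s :=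
    (hsm.hasDerivWithinAt_timeDerivWithin (uniqueDiffOn_Ioc 0 T) ⟨hs.1, hs.2.le⟩ x).hasDerivAt hmem
  have hsl := hd.tendsto_slope_zero_right
  have hτ' : Tendsto τ atTop (𝓝[>] 0) :=
    tendsto_nhdsWithin_of_tendsto_nhds_of_eventually_within τ hτ (Eventually.of_forall fun n => hτpos n)
  exact hsl.comp hτ'

/-! ## §2 No maximiser interval along a classical solution on `(0,T]`, under clause (a) -/

/-- **Clause (a) (classification half) ⟹ no maximiser interval along ANY classical solution on `(0,T]`** with Sobolev bounds on
every `[δ,T]` — in particular along the reference flow through a maximiser. [folklore] -/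
theorem no_maximiserInterval_ref (hA : (∀ c ν : ℝ, (0 < c ∧ (∀ v : EuclideanSpace ℝ (Fin 3) → EuclideanSpace ℝ (Fin 3), (ContDiff ℝ (⊤ : ℕ∞) v ∧ Literature.Analysis.FluidPDE.VectorCalculus.IsDivFree v ∧ (∫⁻ x, ‖iteratedFDeriv ℝ 0 v x‖ₑ ^ 2 < ⊤) ∧ (∫⁻ x, ‖iteratedFDeriv ℝ 1 v x‖ₑ ^ 2 < ⊤) ∧ (∫⁻ x, ‖iteratedFDeriv ℝ 2 v x‖ₑ ^ 2 < ⊤)) → (∫ x, ⟪Literature.Analysis.FluidPDE.curl v x, fderiv ℝ v x (Literature.Analysis.FluidPDE.curl v x)⟫_ℝ) ≤ c * (∫ x, ‖Literature.Analysis.FluidPDE.curl v x‖ ^ 2) ^ (3 / 4 : ℝ) * (∫ x, Literature.Analysis.FluidPDE.frobeniusNormSq (fderiv ℝ (Literature.Analysis.FluidPDE.curl v) x)) ^ (3 / 4 : ℝ)) ∧ ∀ c' : ℝ, (∀ w : EuclideanSpace ℝ (Fin 3) → EuclideanSpace ℝ (Fin 3), (ContDiff ℝ (⊤ : ℕ∞)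 w ∧ Literature.Analysis.FluidPDE.VectorCalculus.IsDivFree w ∧ (∫⁻ x, ‖iteratedFDeriv ℝ 0 w x‖ₑ ^ 2 < ⊤) ∧ (∫⁻ x, ‖iteratedFDeriv ℝ 1 w x‖ₑ ^ 2 < ⊤) ∧ (∫⁻ x, ‖iteratedFDeriv ℝ 2 w x‖ₑ ^ 2 < ⊤)) → (∫ x, ⟪Literature.Analysis.FluidPDE.curl w x, fderiv ℝ w x (Literature.Analysis.FluidPDE.curl w x)⟫_ℝ) ≤ c' * (∫ x, ‖Literature.Analysis.FluidPDE.curl w x‖ ^ 2) ^ (3 / 4 : ℝ) * (∫ x, Literature.Analysis.FluidPDE.frobeniusNormSq (fderiv ℝ (Literature.Analysis.FluidPDE.curl w) x)) ^ (3 / 4 : ℝ)) → c ≤ c') → 0 < ν → ∃ (k : ℕ) (ms : Fin k → EuclideanSpace ℝ (Fin 3) → EuclideanSpace ℝ (Fin 3)), (∀ i, ((ContDiff ℝ (⊤ : ℕ∞) (ms i) ∧ Literature.Analysis.FluidPDE.VectorCalculus.IsDivFree (ms i) ∧ (∫⁻ x, ‖iteratedFDeriv ℝ 0 (ms i) x‖ₑ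 ^ 2 < ⊤) ∧ (∫⁻ x, ‖iteratedFDeriv ℝ 1 (ms i) x‖ₑ ^ 2 < ⊤) ∧ (∫⁻ x, ‖iteratedFDeriv ℝ 2 (ms i) x‖ₑ ^ 2 < ⊤)) ∧ 0 < (∫ x, ‖Literature.Analysis.FluidPDE.curl (ms i) x‖ ^ 2) ∧ (∫ x, ⟪Literature.Analysis.FluidPDE.curl (ms i) x, fderiv ℝ (ms i) x (Literature.Analysis.FluidPDE.curl (ms i) x)⟫_ℝ) = c * (∫ x, ‖Literature.Analysis.FluidPDE.curl (ms i) x‖ ^ 2) ^ (3 / 4 : ℝ) * (∫ x, Literature.Analysis.FluidPDE.frobeniusNormSq (fderiv ℝ (Literature.Analysis.FluidPDE.curl (ms i)) x)) ^ (3 / 4 : ℝ) ∧ (∫ x, Literature.Analysis.FluidPDE.frobeniusNormSq (fderiv ℝ (Literature.Analysis.FluidPDE.curl (ms i)) x)) = 81 * c ^ 4 / (256 * ν ^ 4) * (∫ x, ‖Literature.Analysis.FluidPDE.curl (ms i) x‖ ^ 2) ^ 3)) ∧ ∀ m : EuclideanSpace ℝ (Fin 3) → EuclideanSpace ℝ (Fin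 3), ((ContDiff ℝ (⊤ : ℕ∞) m ∧ Literature.Analysis.FluidPDE.VectorCalculus.IsDivFree m ∧ (∫⁻ x, ‖iteratedFDeriv ℝ 0 m x‖ₑ ^ 2 < ⊤) ∧ (∫⁻ x, ‖iteratedFDeriv ℝ 1 m x‖ₑ ^ 2 < ⊤) ∧ (∫⁻ x, ‖iteratedFDeriv ℝ 2 m x‖ₑ ^ 2 < ⊤)) ∧ 0 < (∫ x, ‖Literature.Analysis.FluidPDE.curl m x‖ ^ 2) ∧ (∫ x, ⟪Literature.Analysis.FluidPDE.curl m x, fderiv ℝ m x (Literature.Analysis.FluidPDE.curl m x)⟫_ℝ) = c * (∫ x, ‖Literature.Analysis.FluidPDE.curl m x‖ ^ 2) ^ (3 / 4 : ℝ) * (∫ x, Literature.Analysis.FluidPDE.frobeniusNormSq (fderiv ℝ (Literature.Analysis.FluidPDE.curl m) x)) ^ (3 / 4 : ℝ) ∧ (∫ x, Literature.Analysis.FluidPDE.frobeniusNormSq (fderiv ℝ (Literature.Analysis.FluidPDE.curl m) x)) = 81 * c ^ 4 / (256 * ν ^ 4) * (∫ x, ‖Literature.Analysis.FluidPDE.curl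 m x‖ ^ 2) ^ 3) → (∃ (i : Fin k) (a : EuclideanSpace ℝ (Fin 3)) (R : EuclideanSpace ℝ (Fin 3) ≃ₗᵢ[ℝ] EuclideanSpace ℝ (Fin 3)) (l : ℝ), 0 < l ∧ m = fun x => l • R (ms i (l • R.symm (x - a))))))
    {c : ℝ} (hsharp : (0 < c ∧ (∀ v : EuclideanSpace ℝ (Fin 3) → EuclideanSpace ℝ (Fin 3), (ContDiff ℝ (⊤ : ℕ∞) v ∧ VectorCalculus.IsDivFree v ∧ (∫⁻ x, ‖iteratedFDeriv ℝ 0 v x‖ₑ ^ 2 < ⊤) ∧ (∫⁻ x, ‖iteratedFDeriv ℝ 1 v x‖ₑ ^ 2 < ⊤) ∧ (∫⁻ x, ‖iteratedFDeriv ℝ 2 v x‖ₑ ^ 2 < ⊤)) → (∫ x, ⟪curl v x, fderiv ℝ v x (curl v x)⟫_ℝ) ≤ c * (∫ x, ‖curl v x‖ ^ 2) ^ (3 / 4 : ℝ) * (∫ x, frobeniusNormSq (fderiv ℝ (curl v) x)) ^ (3 / 4 : ℝ)) ∧ ∀ c' : ℝ, (∀ w : EuclideanSpace ℝ (Fin 3)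 → EuclideanSpace ℝ (Fin 3), (ContDiff ℝ (⊤ : ℕ∞) w ∧ VectorCalculus.IsDivFree w ∧ (∫⁻ x, ‖iteratedFDeriv ℝ 0 w x‖ₑ ^ 2 < ⊤) ∧ (∫⁻ x, ‖iteratedFDeriv ℝ 1 w x‖ₑ ^ 2 < ⊤) ∧ (∫⁻ x, ‖iteratedFDeriv ℝ 2 w x‖ₑ ^ 2 < ⊤)) → (∫ x, ⟪curl w x, fderiv ℝ w x (curl w x)⟫_ℝ) ≤ c' * (∫ x, ‖curl w x‖ ^ 2) ^ (3 / 4 : ℝ) * (∫ x, frobeniusNormSq (fderiv ℝ (curl w) x)) ^ (3 / 4 : ℝ)) → c ≤ c')) {ν T : ℝ} (hν : 0 < ν) (hT : 0 < T)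
    {v : ℝ → EuclideanSpace ℝ (Fin 3) → EuclideanSpace ℝ (Fin 3)} {q : ℝ → EuclideanSpace ℝ (Fin 3) → ℝ}
    (hcl : IsClassicalNSSolutionOn (Ioc 0 T) ν 0 v q)
    (hB : ∀ δ : ℝ, 0 < δ → δ ≤ T → HasBoundedSobolevNormsOn (Icc δ T) v)
    {s s₁ : ℝ} (hs0 : 0 < s) (hss₁ : s < s₁) (hs₁T : s₁ < T) :
    ¬ (∀ σ ∈ Icc s s₁, (((ContDiff ℝ (⊤ : ℕ∞) (v σ) ∧ VectorCalculus.IsDivFree (v σ) ∧ (∫⁻ x, ‖iteratedFDeriv ℝ 0 (v σ) x‖ₑ ^ 2 < ⊤) ∧ (∫⁻ x, ‖iteratedFDeriv ℝ 1 (v σ) x‖ₑ ^ 2 < ⊤) ∧ (∫⁻ x, ‖iteratedFDeriv ℝ 2 (v σ) x‖ₑ ^ 2 < ⊤)) ∧ 0 < (∫ x, ‖curl (v σ) x‖ ^ 2) ∧ (∫ x, ⟪curl (v σ) x, fderiv ℝ (v σ) x (curl (v σ) x)⟫_ℝ) = c * (∫ x, ‖curl (v σ) x‖ ^ 2) ^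 (3 / 4 : ℝ) * (∫ x, frobeniusNormSq (fderiv ℝ (curl (v σ)) x)) ^ (3 / 4 : ℝ) ∧ (∫ x, frobeniusNormSq (fderiv ℝ (curl (v σ)) x)) = 81 * c ^ 4 / (256 * ν ^ 4) * (∫ x, ‖curl (v σ) x‖ ^ 2) ^ 3))) := by
  intro hNM
  have hc : 0 < c := hsharp.1
  have _hT := hT
  obtain ⟨k, ms, hms, hclass⟩ := hA c ν hsharp hν
  have hTC := tangentCone_of_rate (rate_of_classification ms (fun i => ⟨(hms i).1, (hms i).2.1⟩) hclass)
  have hs : s ∈ Ioo 0 T := ⟨hs0, hss₁.trans hs₁T⟩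
  have hZcont : ContinuousAt (fun t => ∫ x, ‖curl (v t) x‖ ^ 2) s := enstrophy_continuousAt hν hcl hB hs
  -- the right difference quotients along the flow, from the maximiser `v s`
  set τ : ℕ → ℝ := fun n => (s₁ - s) / ((n : ℝ) + 2) with hτdef
  have hτpos : ∀ n, 0 < τ n := fun n => div_pos (sub_pos.2 hss₁) (by positivity)
  have hτle : ∀ n, τ n ≤ s₁ - s := fun n => by
    rw [hτdef]
    exact div_le_self (sub_pos.2 hss₁).le (by linarith [(Nat.cast_nonneg n : (0 : ℝ) ≤ n)])
  have hτlim : Tendsto τ atTop (𝓝 0) := by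
    have h1 : Tendsto (fun n : ℕ => ((n : ℝ) + 2)⁻¹) atTop (𝓝 0) :=
      tendsto_inv_atTop_zero.comp (tendsto_natCast_atTop_atTop.atTop_add tendsto_const_nhds)
    have h2 := h1.const_mul (s₁ - s)
    rw [mul_zero] at h2
    refine h2.congr fun n => ?_
    simp only [hτdef, div_eq_mul_inv]
  have hmemI : ∀ n, s + τ n ∈ Icc s s₁ := fun n => ⟨by linarith [hτpos n], by linarith [hτle n]⟩
  have hZconv : Tendsto (fun n => ∫ x, ‖curl (v (s + τ n)) x‖ ^ 2) atTop (𝓝 (∫ x, ‖curl (v s) x‖ ^ 2)) := by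
    have hst : Tendsto (fun n => s + τ n) atTop (𝓝 s) := by
      have := hτlim.const_add s
      rwa [add_zero] at this
    exact hZcont.tendsto.comp hst
  -- `∂ₜv(s)` is a pointwise right tangent of the maximiser set at `v s`
  obtain ⟨d, W, c', hW, hgen⟩ := hTC (v s) (hNM s ⟨le_rfl, hss₁.le⟩) (timeDerivWithin (Ioc 0 T) v s)
    ⟨fun n => v (s + τ n), τ, fun n => hNM _ (hmemI n), hτpos, hτlim, hZconv,
      fun x => tendsto_slope_time_Ioc hcl hs hτpos hτlim x⟩
  -- the momentum equation makes `v s` a relative equilibrium: contradiction with clause (b)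
  have hπ : ContDiff ℝ (⊤ : ℕ∞) (q s) := hcl.contDiff_pressure ⟨hs.1, hs.2.le⟩
  refine partB_holds c ν hc hν (v s) (hNM s ⟨le_rfl, hss₁.le⟩) (q s) d W c' hπ hW fun x => ?_
  have hmom := hcl.momentum s ⟨hs.1, hs.2.le⟩ x
  simp only [Pi.zero_apply, add_zero] at hmom
  rw [← hgen x, show ν • Δ (v s) x - convect (v s) (v s) x - gradient (q s) x =
    (ν • Δ (v s) x - gradient (q s) x) - convect (v s) (v s) x by abel, ← hmom]
  abel

/-! ## §3 (R-exit): the strict early deficit of the reference flow -/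

/-- **(R-exit) under clause (a).** For the sharp constant `c`, `ν > 0`, a normalised maximiser `m` at `(c, ν)`, its reference flow
`(v,q)` on `[0,T]` (Leray–Hopf from `m`, `v 0 = m`, `H¹`-continuous on `[0,T]`, classical on `(0,T]`, Sobolev bounds on every
`[δ,T]`) and `η > 0` with `η·W_m < T`: there is `θ > 0` with `Z(v(η·W_m))²·(1 − η + 4θ) ≤ Z(m)²` (for `η ≥ 1` this is
vacuous bookkeeping; the use is `0 < η < 1`). [folklore] -/
theorem referenceDeficit (hA : (∀ c ν : ℝ, (0 < c ∧ (∀ v : EuclideanSpace ℝ (Fin 3) → EuclideanSpace ℝ (Fin 3), (ContDiff ℝ (⊤ : ℕ∞) v ∧ Literature.Analysis.FluidPDE.VectorCalculus.IsDivFree v ∧ (∫⁻ x, ‖iteratedFDeriv ℝ 0 v x‖ₑ ^ 2 < ⊤) ∧ (∫⁻ x, ‖iteratedFDeriv ℝ 1 v x‖ₑ ^ 2 < ⊤) ∧ (∫⁻ x, ‖iteratedFDeriv ℝ 2 v x‖ₑ ^ 2 < ⊤)) → (∫ x, ⟪Literature.Analysis.FluidPDE.curl v x, fderiv ℝ v x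 (Literature.Analysis.FluidPDE.curl v x)⟫_ℝ) ≤ c * (∫ x, ‖Literature.Analysis.FluidPDE.curl v x‖ ^ 2) ^ (3 / 4 : ℝ) * (∫ x, Literature.Analysis.FluidPDE.frobeniusNormSq (fderiv ℝ (Literature.Analysis.FluidPDE.curl v) x)) ^ (3 / 4 : ℝ)) ∧ ∀ c' : ℝ, (∀ w : EuclideanSpace ℝ (Fin 3) → EuclideanSpace ℝ (Fin 3), (ContDiff ℝ (⊤ : ℕ∞) w ∧ Literature.Analysis.FluidPDE.VectorCalculus.IsDivFree w ∧ (∫⁻ x, ‖iteratedFDeriv ℝ 0 w x‖ₑ ^ 2 < ⊤) ∧ (∫⁻ x, ‖iteratedFDeriv ℝ 1 w x‖ₑ ^ 2 < ⊤) ∧ (∫⁻ x, ‖iteratedFDeriv ℝ 2 w x‖ₑ ^ 2 < ⊤)) → (∫ x, ⟪Literature.Analysis.FluidPDE.curl w x, fderiv ℝ w x (Literature.Analysis.FluidPDE.curl w x)⟫_ℝ) ≤ c' * (∫ x, ‖Literature.Analysis.FluidPDE.curl w x‖ ^ 2) ^ (3 / 4 : ℝ) * (∫ x, Literature.Analysis.FluidPDE.frobeniusNormSq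 (fderiv ℝ (Literature.Analysis.FluidPDE.curl w) x)) ^ (3 / 4 : ℝ)) → c ≤ c') → 0 < ν → ∃ (k : ℕ) (ms : Fin k → EuclideanSpace ℝ (Fin 3) → EuclideanSpace ℝ (Fin 3)), (∀ i, ((ContDiff ℝ (⊤ : ℕ∞) (ms i) ∧ Literature.Analysis.FluidPDE.VectorCalculus.IsDivFree (ms i) ∧ (∫⁻ x, ‖iteratedFDeriv ℝ 0 (ms i) x‖ₑ ^ 2 < ⊤) ∧ (∫⁻ x, ‖iteratedFDeriv ℝ 1 (ms i) x‖ₑ ^ 2 < ⊤) ∧ (∫⁻ x, ‖iteratedFDeriv ℝ 2 (ms i) x‖ₑ ^ 2 < ⊤)) ∧ 0 < (∫ x, ‖Literature.Analysis.FluidPDE.curl (ms i) x‖ ^ 2) ∧ (∫ x, ⟪Literature.Analysis.FluidPDE.curl (ms i) x, fderiv ℝ (ms i) x (Literature.Analysis.FluidPDE.curl (ms i) x)⟫_ℝ) = c * (∫ x, ‖Literature.Analysis.FluidPDE.curl (ms i) x‖ ^ 2) ^ (3 / 4 : ℝ) * (∫ x, Literature.Analysis.FluidPDE.frobeniusNormSq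 (fderiv ℝ (Literature.Analysis.FluidPDE.curl (ms i)) x)) ^ (3 / 4 : ℝ) ∧ (∫ x, Literature.Analysis.FluidPDE.frobeniusNormSq (fderiv ℝ (Literature.Analysis.FluidPDE.curl (ms i)) x)) = 81 * c ^ 4 / (256 * ν ^ 4) * (∫ x, ‖Literature.Analysis.FluidPDE.curl (ms i) x‖ ^ 2) ^ 3)) ∧ ∀ m : EuclideanSpace ℝ (Fin 3) → EuclideanSpace ℝ (Fin 3), ((ContDiff ℝ (⊤ : ℕ∞) m ∧ Literature.Analysis.FluidPDE.VectorCalculus.IsDivFree m ∧ (∫⁻ x, ‖iteratedFDeriv ℝ 0 m x‖ₑ ^ 2 < ⊤) ∧ (∫⁻ x, ‖iteratedFDeriv ℝ 1 m x‖ₑ ^ 2 < ⊤) ∧ (∫⁻ x, ‖iteratedFDeriv ℝ 2 m x‖ₑ ^ 2 < ⊤)) ∧ 0 < (∫ x, ‖Literature.Analysis.FluidPDE.curl m x‖ ^ 2) ∧ (∫ x, ⟪Literature.Analysis.FluidPDE.curl m x, fderiv ℝ m x (Literature.Analysis.FluidPDE.curl m x)⟫_ℝ) = c * (∫ x, ‖Literature.Analysis.FluidPDE.curl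 m x‖ ^ 2) ^ (3 / 4 : ℝ) * (∫ x, Literature.Analysis.FluidPDE.frobeniusNormSq (fderiv ℝ (Literature.Analysis.FluidPDE.curl m) x)) ^ (3 / 4 : ℝ) ∧ (∫ x, Literature.Analysis.FluidPDE.frobeniusNormSq (fderiv ℝ (Literature.Analysis.FluidPDE.curl m) x)) = 81 * c ^ 4 / (256 * ν ^ 4) * (∫ x, ‖Literature.Analysis.FluidPDE.curl m x‖ ^ 2) ^ 3) → (∃ (i : Fin k) (a : EuclideanSpace ℝ (Fin 3)) (R : EuclideanSpace ℝ (Fin 3) ≃ₗᵢ[ℝ] EuclideanSpace ℝ (Fin 3)) (l : ℝ), 0 < l ∧ m = fun x => l • R (ms i (l • R.symm (x - a))))))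
    {c : ℝ} (hsharp : (0 < c ∧ (∀ v : EuclideanSpace ℝ (Fin 3) → EuclideanSpace ℝ (Fin 3), (ContDiff ℝ (⊤ : ℕ∞) v ∧ VectorCalculus.IsDivFree v ∧ (∫⁻ x, ‖iteratedFDeriv ℝ 0 v x‖ₑ ^ 2 < ⊤) ∧ (∫⁻ x, ‖iteratedFDeriv ℝ 1 v x‖ₑ ^ 2 < ⊤) ∧ (∫⁻ x, ‖iteratedFDeriv ℝ 2 v x‖ₑ ^ 2 < ⊤)) → (∫ x, ⟪curl v x, fderiv ℝ v x (curl v x)⟫_ℝ) ≤ c * (∫ x, ‖curl v x‖ ^ 2) ^ (3 / 4 : ℝ) * (∫ x, frobeniusNormSq (fderiv ℝ (curl v) x)) ^ (3 / 4 : ℝ)) ∧ ∀ c' : ℝ, (∀ w : EuclideanSpace ℝ (Fin 3) → EuclideanSpace ℝ (Fin 3), (ContDiff ℝ (⊤ : ℕ∞) w ∧ VectorCalculus.IsDivFree w ∧ (∫⁻ x, ‖iteratedFDeriv ℝ 0 w x‖ₑ ^ 2 < ⊤) ∧ (∫⁻ x, ‖iteratedFDeriv ℝ 1 w x‖ₑ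 ^ 2 < ⊤) ∧ (∫⁻ x, ‖iteratedFDeriv ℝ 2 w x‖ₑ ^ 2 < ⊤)) → (∫ x, ⟪curl w x, fderiv ℝ w x (curl w x)⟫_ℝ) ≤ c' * (∫ x, ‖curl w x‖ ^ 2) ^ (3 / 4 : ℝ) * (∫ x, frobeniusNormSq (fderiv ℝ (curl w) x)) ^ (3 / 4 : ℝ)) → c ≤ c')) {ν T : ℝ} (hν : 0 < ν) (hT : 0 < T)
    {m : EuclideanSpace ℝ (Fin 3) → EuclideanSpace ℝ (Fin 3)} (hm : (((ContDiff ℝ (⊤ : ℕ∞) m ∧ VectorCalculus.IsDivFree m ∧ (∫⁻ x, ‖iteratedFDeriv ℝ 0 m x‖ₑ ^ 2 < ⊤) ∧ (∫⁻ x, ‖iteratedFDeriv ℝ 1 m x‖ₑ ^ 2 < ⊤) ∧ (∫⁻ x, ‖iteratedFDeriv ℝ 2 m x‖ₑ ^ 2 < ⊤)) ∧ 0 < (∫ x, ‖curl m x‖ ^ 2) ∧ (∫ x, ⟪curl m x, fderiv ℝ m x (curl m x)⟫_ℝ) = c * (∫ x, ‖curl m x‖ ^ 2) ^ (3 / 4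 : ℝ) * (∫ x, frobeniusNormSq (fderiv ℝ (curl m) x)) ^ (3 / 4 : ℝ) ∧ (∫ x, frobeniusNormSq (fderiv ℝ (curl m) x)) = 81 * c ^ 4 / (256 * ν ^ 4) * (∫ x, ‖curl m x‖ ^ 2) ^ 3)))
    {v : ℝ → EuclideanSpace ℝ (Fin 3) → EuclideanSpace ℝ (Fin 3)} {q : ℝ → EuclideanSpace ℝ (Fin 3) → ℝ}
    (hLH : IsLerayHopfOn T ν 0 m v) (hv0 : v 0 = m) (hH1 : IsH1RegularOn (Icc 0 T) v)
    (hcl : IsClassicalNSSolutionOn (Ioc 0 T) ν 0 v q)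
    (hB : ∀ δ : ℝ, 0 < δ → δ ≤ T → HasBoundedSobolevNormsOn (Icc δ T) v)
    {η : ℝ} (hη0 : 0 < η) (hηT : η * (64 * ν ^ 3 / (27 * c ^ 4) * (∫ x, ‖curl m x‖ ^ 2)⁻¹ ^ 2) < T) :
    ∃ θ : ℝ, 0 < θ ∧ (∫ x, ‖curl (v (η * (64 * ν ^ 3 / (27 * c ^ 4) * (∫ x, ‖curl m x‖ ^ 2)⁻¹ ^ 2))) x‖ ^ 2) ^ 2 * (1 - η + 4 * θ) ≤ (∫ x, ‖curl m x‖ ^ 2) ^ 2 := by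
  have hc : 0 < c := hsharp.1
  have hadm := hsharp.2.1
  have hmadm := hm.1
  have hZm : 0 < ∫ x, ‖curl m x‖ ^ 2 := hm.2.1
  set Z : ℝ → ℝ := fun t => ∫ x, ‖curl (v t) x‖ ^ 2 with hZdef
  set Zm : ℝ := ∫ x, ‖curl m x‖ ^ 2 with hZm'
  set K : ℝ := 27 * c ^ 4 / (128 * ν ^ 3) with hK
  set W : ℝ := 64 * ν ^ 3 / (27 * c ^ 4) * Zm⁻¹ ^ 2 with hWdef
  have hKpos : 0 < K := by positivity
  have hWpos : 0 < W := by positivity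
  have h2KW : 2 * K * W = Zm⁻¹ ^ 2 := by rw [hK, hWdef]; field_simp; ring
  have hZ0 : ∀ t, 0 ≤ Z t := fun t => integral_nonneg fun x => by positivity
  show ∃ θ : ℝ, 0 < θ ∧ (Z (η * W)) ^ 2 * (1 - η + 4 * θ) ≤ Zm ^ 2
  rcases (hZ0 (η * W)).eq_or_lt with hz | hz
  · exact ⟨1, one_pos, by rw [← hz, zero_pow two_ne_zero, zero_mul]; positivity⟩
  -- positive case: positivity on `[0, ηW]` and a little beyond
  have hηW : η * W ∈ Ioo 0 T := ⟨by positivity, hηT⟩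
  have hposL := enstrophy_pos_of_pos_right hν hT hLH hv0 hH1 hcl hB hmadm hadm hZm hηW hz
  obtain ⟨t₂, ht₂t, ht₂T, hpos₂⟩ : ∃ t₂, η * W < t₂ ∧ t₂ ≤ T ∧ ∀ τ ∈ Icc (η * W) t₂, 0 < Z τ := by
    have hev : ∀ᶠ τ in 𝓝 (η * W), 0 < Z τ := (enstrophy_continuousAt hν hcl hB hηW).eventually (lt_mem_nhds hz)
    obtain ⟨ε, hε, hball⟩ := Metric.eventually_nhds_iff.1 hev
    refine ⟨min (η * W + ε / 2) T, lt_min (by linarith) hηT, min_le_right _ _, fun τ hτ => hball ?_⟩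
    rw [Real.dist_eq, abs_lt]
    constructor <;> linarith [hτ.1, hτ.2, min_le_left (η * W + ε / 2) T]
  have hposAll : ∀ τ ∈ Ico 0 t₂, 0 < Z τ := fun τ hτ => by
    rcases le_or_gt τ (η * W) with h | h
    · exact hposL τ ⟨hτ.1, h⟩
    · exact hpos₂ τ ⟨h.le, hτ.2.le⟩
  have hηWpos : 0 < η * W := mul_pos hη0 hWpos
  -- a non-maximiser instant in `[ηW/3, 2ηW/3]`
  have hint := no_maximiserInterval_ref hA hsharp hν hT hcl hB (s := η * W / 3) (s₁ := 2 * (η * W) / 3)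
    (by positivity) (by linarith) (by linarith)
  obtain ⟨σ, hσ'⟩ := not_forall.mp hint
  obtain ⟨hσ, hσNM⟩ := Classical.not_imp.mp hσ'
  have hσI : σ ∈ Ioo 0 T := ⟨by linarith [hσ.1], by linarith [hσ.2]⟩
  have hσadm := slice_admissible hcl hB ⟨hσI.1, hσI.2.le⟩
  have hZσ : 0 < Z σ := hposAll σ ⟨hσI.1.le, by linarith [hσ.2]⟩
  -- it is a STRICT instant of the cubic law
  have hbudσ := budget hν hcl hB hadm hσI
  have hstrict : 2 * (∫ x, ⟪curl (v σ) x, fderiv ℝ (v σ) x (curl (v σ) x)⟫_ℝ) -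
      2 * ν * (∫ x, frobeniusNormSq (fderiv ℝ (curl (v σ)) x)) < K * Z σ ^ 3 := by
    refine lt_of_le_of_ne hbudσ.2 fun heq => hσNM ?_
    exact (normalisedMaximiser_iff_saturated hc hadm hν (v σ)).2 ⟨hσadm, hZσ, by rw [hK] at heq; exact heq.symm.le⟩
  -- strict integrated law from `ηW/6` to `ηW`
  have hder : ∀ τ ∈ Ico (η * W / 6) t₂, ∃ D : ℝ, HasDerivAt Z D τ ∧ D ≤ K * Z τ ^ 3 := fun τ hτ =>
    ⟨_, (budget hν hcl hB hadm ⟨by linarith [hτ.1, mul_pos hη0 hWpos], hτ.2.trans_le ht₂T⟩).1,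
      (budget hν hcl hB hadm ⟨by linarith [hτ.1, mul_pos hη0 hWpos], hτ.2.trans_le ht₂T⟩).2⟩
  have hlt := inv_sq_sub_lt_of_strict_instant (Zr := Z) (t₁ := η * W / 6) (T := t₂) (K := K)
    (fun τ hτ => hposAll τ ⟨by linarith [hτ.1, mul_pos hη0 hWpos], hτ.2⟩) hder
    (s := η * W / 6) (τ₀ := σ) (s' := η * W) le_rfl (by linarith [hσ.1]) (by linarith [hσ.2]) ht₂t hbudσ.1 hstrict
  -- window ceiling from `0` to `ηW/6`, in inverse form
  have hceil := enstrophy_sq_mul_le hν hT hLH hv0 hH1 hcl hB hmadm hadm hZm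
    (t := η * W / 6) ⟨by positivity, by linarith [hηT]⟩
  have hZ6 : 0 < Z (η * W / 6) := hposAll _ ⟨by positivity, by linarith⟩
  have hinv6 : Zm⁻¹ ^ 2 - 2 * K * (η * W / 6) ≤ (Z (η * W / 6))⁻¹ ^ 2 := by
    -- from `Z(t)² (1 − 2K Zm² t) ≤ Zm²`
    have h1 : (Z (η * W / 6)) ^ 2 * (1 - 2 * K * Zm ^ 2 * (η * W / 6)) ≤ Zm ^ 2 := hceil
    have hZm2 : 0 < Zm ^ 2 := pow_pos hZm 2
    have hZ62 : 0 < Z (η * W / 6) ^ 2 := pow_pos hZ6 2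
    rw [inv_pow, inv_pow]
    rw [show (Zm ^ 2)⁻¹ - 2 * K * (η * W / 6) = (1 - 2 * K * Zm ^ 2 * (η * W / 6)) / Zm ^ 2 by
      field_simp]
    rw [div_le_iff₀ hZm2, ← div_eq_inv_mul, le_div_iff₀ hZ62, mul_comm]
    exact h1
  -- combine: `Z(ηW)⁻² > (1 − η) Zm⁻²`
  have hgt : (1 - η) * Zm⁻¹ ^ 2 < (Z (η * W))⁻¹ ^ 2 := by
    have h3 : 2 * K * (η * W - η * W / 6) + 2 * K * (η * W / 6) = η * Zm⁻¹ ^ 2 := by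
      rw [← h2KW]; ring
    linarith [hlt, hinv6, h3]
  have hzne : Z (η * W) ≠ 0 := hz.ne'
  -- choose `θ`
  refine ⟨((Z (η * W))⁻¹ ^ 2 * Zm ^ 2 - (1 - η)) / 4, ?_, ?_⟩
  · have h4 : (1 - η) < (Z (η * W))⁻¹ ^ 2 * Zm ^ 2 := by
      have h5 : (1 - η) * Zm⁻¹ ^ 2 * Zm ^ 2 = 1 - η := by field_simp
      have h6 := mul_lt_mul_of_pos_right hgt (pow_pos hZm 2)
      rwa [h5] at h6
    linarith
  · have h7 : 1 - η + 4 * (((Z (η * W))⁻¹ ^ 2 * Zm ^ 2 - (1 - η)) / 4) = (Z (η * W))⁻¹ ^ 2 * Zm ^ 2 := by ring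
    rw [h7]
    have h8 : Z (η * W) ^ 2 * ((Z (η * W))⁻¹ ^ 2 * Zm ^ 2) = Zm ^ 2 := by field_simp
    rw [h8]

/-- **(R-exit) from the route decl `MaximiserSetRigidity`**, BY NAME. [folklore] -/
theorem referenceDeficit_of_maximiserSetRigidity
    (hMSR : Summit.NavierStokesRegularity.NavierStokesRegularity.Theses.EfficiencyFloor.MaximiserSetRigidity)
    {c : ℝ} (hsharp : (0 < c ∧ (∀ v : EuclideanSpace ℝ (Fin 3) → EuclideanSpace ℝ (Fin 3), (ContDiff ℝ (⊤ : ℕ∞) v ∧ VectorCalculus.IsDivFree v ∧ (∫⁻ x, ‖iteratedFDeriv ℝ 0 v x‖ₑ ^ 2 < ⊤) ∧ (∫⁻ x, ‖iteratedFDeriv ℝ 1 v x‖ₑ ^ 2 < ⊤) ∧ (∫⁻ x, ‖iteratedFDeriv ℝ 2 v x‖ₑ ^ 2 < ⊤)) → (∫ x, ⟪curl v x, fderiv ℝ v x (curl v x)⟫_ℝ) ≤ c * (∫ x, ‖curl v x‖ ^ 2) ^ (3 / 4 : ℝ) * (∫ x, frobeniusNormSq (fderiv ℝ (curl v) x)) ^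 (3 / 4 : ℝ)) ∧ ∀ c' : ℝ, (∀ w : EuclideanSpace ℝ (Fin 3) → EuclideanSpace ℝ (Fin 3), (ContDiff ℝ (⊤ : ℕ∞) w ∧ VectorCalculus.IsDivFree w ∧ (∫⁻ x, ‖iteratedFDeriv ℝ 0 w x‖ₑ ^ 2 < ⊤) ∧ (∫⁻ x, ‖iteratedFDeriv ℝ 1 w x‖ₑ ^ 2 < ⊤) ∧ (∫⁻ x, ‖iteratedFDeriv ℝ 2 w x‖ₑ ^ 2 < ⊤)) → (∫ x, ⟪curl w x, fderiv ℝ w x (curl w x)⟫_ℝ) ≤ c' * (∫ x, ‖curl w x‖ ^ 2) ^ (3 / 4 : ℝ) * (∫ x, frobeniusNormSq (fderiv ℝ (curl w) x)) ^ (3 / 4 : ℝ)) → c ≤ c')) {ν T : ℝ} (hν : 0 < ν) (hT : 0 < T)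
    {m : EuclideanSpace ℝ (Fin 3) → EuclideanSpace ℝ (Fin 3)} (hm : (((ContDiff ℝ (⊤ : ℕ∞) m ∧ VectorCalculus.IsDivFree m ∧ (∫⁻ x, ‖iteratedFDeriv ℝ 0 m x‖ₑ ^ 2 < ⊤) ∧ (∫⁻ x, ‖iteratedFDeriv ℝ 1 m x‖ₑ ^ 2 < ⊤) ∧ (∫⁻ x, ‖iteratedFDeriv ℝ 2 m x‖ₑ ^ 2 < ⊤)) ∧ 0 < (∫ x, ‖curl m x‖ ^ 2) ∧ (∫ x, ⟪curl m x, fderiv ℝ m x (curl m x)⟫_ℝ) = c * (∫ x, ‖curl m x‖ ^ 2) ^ (3 / 4 : ℝ) * (∫ x, frobeniusNormSq (fderiv ℝ (curl m) x)) ^ (3 / 4 : ℝ) ∧ (∫ x, frobeniusNormSq (fderiv ℝ (curl m) x)) = 81 * c ^ 4 / (256 * ν ^ 4) * (∫ x, ‖curl m x‖ ^ 2) ^ 3)))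
    {v : ℝ → EuclideanSpace ℝ (Fin 3) → EuclideanSpace ℝ (Fin 3)} {q : ℝ → EuclideanSpace ℝ (Fin 3) → ℝ}
    (hLH : IsLerayHopfOn T ν 0 m v) (hv0 : v 0 = m) (hH1 : IsH1RegularOn (Icc 0 T) v)
    (hcl : IsClassicalNSSolutionOn (Ioc 0 T) ν 0 v q)
    (hB : ∀ δ : ℝ, 0 < δ → δ ≤ T → HasBoundedSobolevNormsOn (Icc δ T) v)
    {η : ℝ} (hη0 : 0 < η) (hηT : η * (64 * ν ^ 3 / (27 * c ^ 4) * (∫ x, ‖curl m x‖ ^ 2)⁻¹ ^ 2) < T) :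
    ∃ θ : ℝ, 0 < θ ∧ (∫ x, ‖curl (v (η * (64 * ν ^ 3 / (27 * c ^ 4) * (∫ x, ‖curl m x‖ ^ 2)⁻¹ ^ 2))) x‖ ^ 2) ^ 2 * (1 - η + 4 * θ) ≤ (∫ x, ‖curl m x‖ ^ 2) ^ 2 :=
  referenceDeficit (partA_of_maximiserSetRigidity hMSR) hsharp hν hT hm hLH hv0 hH1 hcl hB hη0 hηT

end ReferenceExit

end RigidExit

end Summit.NavierStokesRegularity.NavierStokesRegularity.Theorems

end
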